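import Summits.KontsevichZagierPeriods.KontsevichZagierPeriods.Theorems.LinRedNormalFormArrangementNormalFormSeparateHighCuts
import Summits.KontsevichZagierPeriods.KontsevichZagierPeriods.Theorems.LinRedNormalFormArrangementNormalFormSeparateTwoZeroCandidates
import Summits.KontsevichZagierPeriods.KontsevichZagierPeriods.Theorems.LinRedNormalFormArrangementNormalFormSeparateHighFanSlopes

/-!
# The fan lemma of `stub_separateHigh`: every Janus band is a sum of pieces with good directions

(Line `janus-bands`, crux `ArrangementNormalForm`, stub `stub_separateHigh` — separation in base
dimension `≥ 3`; part `FanLemma` (registered as `separateHigh_fan`), valid in every base dimension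
`B + 2 ≥ 2`.)

**Theorem** (`separateHigh_fan`). Every Janus band representation `s` over the base `ℝ^{B+2}`
with `k` fibres (literal `JJ (B+2) k` data: letters `L, e`, numerator `p`, fibre data
`a, lo, hi`) is congruent modulo `KZ.relations` to a `ℤ`-combination of pieces `s₁` of the
same integrand on rational sub-cells, each equipped with a rational direction `v`
(`v_{last} ≠ 0`) such that (1) every `v`-active letter (`∂ᵥL_j ≠ 0`, `e_j ≠ 0`) does not
vanish on `s₁.domain` and (2) the RATIO condition `|L_{j'}| ≤ C |∂ᵥL_j · L_{j'} − ∂ᵥL_{j'} · L_j|`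
holds on `s₁.domain` for every ordered pair of `v`-active non-proportional letters. This is
exactly the fan certificate consumed by `separateHigh_of_fan_carry` / `separateHigh_of_fan`.

Proof (no smallness, no compactness). Let `P` be the set of ordered pairs of active letters
with independent linear parts, `N = 2 (B+1) #P + 1`, and `v_0, …, v_{N-1}` the moment-curve
candidates (`SepHigh.cand`). Dissect the cell (rule 1a, `SepHigh.cuts`) along every active
letter AND along every resultant hyperplane `∂L_j · L_{j'} − ∂L_{j'} · L_j = 0` (`SepHigh.resForm`,
a rational hyperplane through the flat `{L_j = L_{j'} = 0}`) of every pair `q ∈ P` and every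
candidate moving both letters. On a piece all these forms have constant strict signs; in the
plane of the values `(L_j, L_{j'})` the piece lies in an open quadrant and no candidate line
crosses it, so (`SepHigh.three_slopes`) the candidates violating the ratio condition for `q` have
at most two slopes, hence (quantitative independence of the candidates, `SepHigh.exists_eta`)
number at most `2 (B+1)`; summing over `q ∈ P` leaves a good candidate for the piece
(`SepHigh.exists_fan_cand`). Parallel non-proportional pairs have constant non-zero resultants
(`SepHigh.res_const_of_dep`). The conical refinement at the flats touching the closed cell is
thus performed by the resultant hyperplanes themselves.
-/

noncomputable section

open Set MeasureTheory MvPolynomial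

namespace Summit.KontsevichZagierPeriods.ArrangementNormalForm.JanusBands

open Literature.NumberTheory.Transcendental

open SeparatePos SepHigh in
/-- **The fan lemma** (registered part `separateHigh_fan` of `stub_separateHigh`; every base
dimension `B + 2 ≥ 2`): every Janus band representation is congruent modulo `KZ.relations` to a
`ℤ`-combination of pieces of the same integrand on rational sub-cells each carrying a rational
direction `v` (`v_{last} ≠ 0`) along which the active letters do not vanish on the piece and
every pair of active non-proportional letters satisfies the ratio condition; see the module
docstring. [Kontsevich–Zagier 2001, §1.2] -/
theorem separateHigh_fan (B k m m' : ℕ) (s : KZ.IntegralRep (B + 2 + k)) (M : Fin m' → (Fin (B + 2) → ℚ) × ℚ) (L : Fin m → (Fin (B + 2) → ℚ) × ℚ) (e : Fin m → ℕ) (p : MvPolynomial (Fin (B + 2)) ℚ) (a : Fin k → Option ((Fin (B + 2) → ℚ) × ℚ)) (lo hi : Fin k → Fin k ⊕ ((Fin (B + 2) → ℚ) × ℚ)) (hbd : Bornology.IsBounded s.domain) (hdom : s.domain = {z | (∀ j, 0 < ∑ i, ((M j).1 i : ℝ) * z (Fin.castAdd k i) + ((M j).2 : ℝ)) ∧ ∀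 i, Sum.elim (fun j => z (Fin.natAdd (B + 2) j)) (fun c => ∑ i', (c.1 i' : ℝ) * z (Fin.castAdd k i') + (c.2 : ℝ)) (lo i) < z (Fin.natAdd (B + 2) i) ∧ z (Fin.natAdd (B + 2) i) < Sum.elim (fun j => z (Fin.natAdd (B + 2) j)) (fun c => ∑ i', (c.1 i' : ℝ) * z (Fin.castAdd k i') + (c.2 : ℝ)) (hi i)}) (hint : EqOn s.integrand (fun z => MvPolynomial.aeval (fun i => z (Fin.castAdd k i)) p / (∏ j, (∑ i, ((L j).1 i : ℝ) * z (Fin.castAdd k i) + ((L j).2 : ℝ)) ^ e j) * ∏ i, (a i).elim 1 (fun c => 1 / (z (Fin.natAdd (B + 2) i) - (∑ i', (c.1 i' : ℝ) * z (Fin.castAdd k i') + (c.2 : ℝ))))) s.domain) : ∃ c ∈ AddSubgroup.closure {w : KZ.FormalRep | ∃ (m₁ : ℕ) (M₁ : Fin m₁ → (Fin (B + 2) → ℚ) × ℚ) (s₁ : KZ.IntegralRep (B + 2 + k)) (v : Fin (B + 2) → ℚ), v (Fin.last (B + 1)) ≠ 0 ∧ Bornology.IsBounded s₁.domain ∧ s₁.domain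 = {z | (∀ j, 0 < ∑ i, ((M₁ j).1 i : ℝ) * z (Fin.castAdd k i) + ((M₁ j).2 : ℝ)) ∧ ∀ i, Sum.elim (fun j => z (Fin.natAdd (B + 2) j)) (fun c => ∑ i', (c.1 i' : ℝ) * z (Fin.castAdd k i') + (c.2 : ℝ)) (lo i) < z (Fin.natAdd (B + 2) i) ∧ z (Fin.natAdd (B + 2) i) < Sum.elim (fun j => z (Fin.natAdd (B + 2) j)) (fun c => ∑ i', (c.1 i' : ℝ) * z (Fin.castAdd k i') + (c.2 : ℝ)) (hi i)} ∧ EqOn s₁.integrand (fun z => MvPolynomial.aeval (fun i => z (Fin.castAdd k i)) p / (∏ j, (∑ i, ((L j).1 i : ℝ) * z (Fin.castAdd k i) + ((L j).2 : ℝ)) ^ e j) * ∏ i, (a i).elim 1 (fun c => 1 / (z (Fin.natAdd (B + 2) i) - (∑ i', (c.1 i' : ℝ) * z (Fin.castAdd k i') + (c.2 : ℝ))))) s₁.domain ∧ (∀ j, (∑ i, (L j).1 i * v i) ≠ 0 → e j ≠ 0 → ∀ z ∈ s₁.domain, ∑ i, ((L j).1 i : ℝ) * z (Fin.castAdd k i)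 + ((L j).2 : ℝ) ≠ 0) ∧ (∀ j j', (∑ i, (L j).1 i * v i) ≠ 0 → (∑ i, (L j').1 i * v i) ≠ 0 → e j ≠ 0 → e j' ≠ 0 → (∑ i, (L j').1 i * v i) • L j ≠ (∑ i, (L j).1 i * v i) • L j' → ∃ C : ℝ, ∀ z ∈ s₁.domain, |∑ i, ((L j').1 i : ℝ) * z (Fin.castAdd k i) + ((L j').2 : ℝ)| ≤ C * |(((∑ i, (L j).1 i * v i) : ℚ) : ℝ) * (∑ i, ((L j').1 i : ℝ) * z (Fin.castAdd k i) + ((L j').2 : ℝ)) - (((∑ i, (L j').1 i * v i) : ℚ) : ℝ) * (∑ i, ((L j).1 i : ℝ) * z (Fin.castAdd k i) + ((L j).2 : ℝ))|) ∧ w = KZ.of s₁}, KZ.of s - c ∈ KZ.relations := by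
  classical
  -- Step 0: a vanishing active letter makes the integrand zero
  by_cases hL : ∃ j, e j ≠ 0 ∧ L j = 0
  · obtain ⟨j, hej, hLj⟩ := hL
    refine ⟨0, zero_mem _, ?_⟩
    rw [sub_zero]
    refine KZ.of_mem_relations_of_eqOn_zero s fun z hz => ?_
    rw [hint hz]
    have h0 : (∑ i', ((L j).1 i' : ℝ) * z (Fin.castAdd k i') + ((L j).2 : ℝ)) ^ e j = 0 := by
      rw [hLj]
      simp [zero_pow hej]
    simp only [Pi.zero_apply]
    rw [Finset.prod_eq_zero (Finset.mem_univ j) h0, div_zero, zero_mul]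
  push Not at hL
  -- Step 1: the pairs, the candidates, the cut set (fixed before dissecting)
  obtain ⟨R₀, hR₀⟩ := hbd.exists_norm_le
  have hcoord : ∀ z ∈ s.domain, ∀ i, |z (Fin.castAdd k i)| ≤ R₀ := fun z hz i => by
    have h1 := norm_le_pi_norm z (Fin.castAdd k i)
    rw [Real.norm_eq_abs] at h1
    exact h1.trans (hR₀ z hz)
  set P : Finset (Fin m × Fin m) := Finset.univ.filter fun q => e q.1 ≠ 0 ∧ e q.2 ≠ 0 ∧
    ∀ μ ν : ℚ, μ • (L q.1).1 + ν • (L q.2).1 = 0 → μ = 0 ∧ ν = 0 with hP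
  set N : ℕ := 2 * (B + 1) * P.card + 1 with hN
  have hNP : 2 * (B + 2 - 1) * P.card < N := by
    rw [hN, show B + 2 - 1 = B + 1 by omega]
    exact Nat.lt_succ_self _
  obtain ⟨η, hη, hηbad⟩ := exists_eta (B + 2) N
  set S : Finset ((Fin (B + 2) → ℚ) × ℚ) := (Finset.univ.filter fun j => e j ≠ 0).image L ∪
    ((P ×ˢ Finset.range N).filter fun ql => dv (L ql.1.1) (cand (B + 2) ql.2) ≠ 0 ∧
      dv (L ql.1.2) (cand (B + 2) ql.2) ≠ 0).image
      (fun ql => resForm (L ql.1.1) (L ql.1.2) (cand (B + 2) ql.2)) with hS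
  have hS0 : (0 : (Fin (B + 2) → ℚ) × ℚ) ∉ S := by
    intro h0
    rcases Finset.mem_union.1 h0 with h0 | h0
    · obtain ⟨j, hj, hj0⟩ := Finset.mem_image.1 h0
      exact hL j (Finset.mem_filter.1 hj).2 hj0
    · obtain ⟨ql, hql, hql0⟩ := Finset.mem_image.1 h0
      obtain ⟨hql1, hα, -⟩ := Finset.mem_filter.1 hql
      have hq : ql.1 ∈ P := (Finset.mem_product.1 hql1).1
      exact resForm_ne_zero _ _ _ (Finset.mem_filter.1 hq).2.2.2 (Or.inl hα) hql0
  have hSL : ∀ j, e j ≠ 0 → L j ∈ S := fun j hej =>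
    Finset.mem_union_left _ (Finset.mem_image_of_mem L (Finset.mem_filter.2 ⟨Finset.mem_univ j, hej⟩))
  have hSR : ∀ q ∈ P, ∀ l < N, dv (L q.1) (cand (B + 2) l) ≠ 0 → dv (L q.2) (cand (B + 2) l) ≠ 0 →
      resForm (L q.1) (L q.2) (cand (B + 2) l) ∈ S := fun q hq l hl hα hβ =>
    Finset.mem_union_right _ (Finset.mem_image.2 ⟨(q, l), Finset.mem_filter.2
      ⟨Finset.mem_product.2 ⟨hq, Finset.mem_range.2 hl⟩, hα, hβ⟩, rfl⟩)
  -- Step 2: dissect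
  obtain ⟨c, hc, hrel⟩ := cuts L e p a lo hi S hS0 m' M s hbd hdom hint
  suffices hpieces : ∀ w ∈ Pieces (B + 2) k m L e p a lo hi S m' M,
      ∃ c' ∈ AddSubgroup.closure {w : KZ.FormalRep | ∃ (m₁ : ℕ) (M₁ : Fin m₁ → (Fin (B + 2) → ℚ) × ℚ)
      (s₁ : KZ.IntegralRep (B + 2 + k)) (v : Fin (B + 2) → ℚ), v (Fin.last (B + 1)) ≠ 0 ∧
      Bornology.IsBounded s₁.domain ∧
      s₁.domain = {z | (∀ j, 0 < ∑ i, ((M₁ j).1 i : ℝ) * z (Fin.castAdd k i) + ((M₁ j).2 : ℝ)) ∧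
        ∀ i, Sum.elim (fun j => z (Fin.natAdd (B + 2) j)) (fun c => ∑ i', (c.1 i' : ℝ) *
          z (Fin.castAdd k i') + (c.2 : ℝ)) (lo i) < z (Fin.natAdd (B + 2) i) ∧
          z (Fin.natAdd (B + 2) i) < Sum.elim (fun j => z (Fin.natAdd (B + 2) j))
          (fun c => ∑ i', (c.1 i' : ℝ) * z (Fin.castAdd k i') + (c.2 : ℝ)) (hi i)} ∧
      EqOn s₁.integrand (fun z => MvPolynomial.aeval (fun i => z (Fin.castAdd k i)) p /
        (∏ j, (∑ i, ((L j).1 i : ℝ) * z (Fin.castAdd k i) + ((L j).2 : ℝ)) ^ e j) *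
        ∏ i, (a i).elim 1 (fun c => 1 / (z (Fin.natAdd (B + 2) i) -
          (∑ i', (c.1 i' : ℝ) * z (Fin.castAdd k i') + (c.2 : ℝ))))) s₁.domain ∧
      (∀ j, (∑ i, (L j).1 i * v i) ≠ 0 → e j ≠ 0 → ∀ z ∈ s₁.domain,
        ∑ i, ((L j).1 i : ℝ) * z (Fin.castAdd k i) + ((L j).2 : ℝ) ≠ 0) ∧
      (∀ j j', (∑ i, (L j).1 i * v i) ≠ 0 → (∑ i, (L j').1 i * v i) ≠ 0 → e j ≠ 0 → e j' ≠ 0 →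
        (∑ i, (L j').1 i * v i) • L j ≠ (∑ i, (L j).1 i * v i) • L j' →
        ∃ C : ℝ, ∀ z ∈ s₁.domain, |∑ i, ((L j').1 i : ℝ) * z (Fin.castAdd k i) + ((L j').2 : ℝ)| ≤
          C * |(((∑ i, (L j).1 i * v i) : ℚ) : ℝ) * (∑ i, ((L j').1 i : ℝ) * z (Fin.castAdd k i) +
            ((L j').2 : ℝ)) - (((∑ i, (L j').1 i * v i) : ℚ) : ℝ) *
            (∑ i, ((L j).1 i : ℝ) * z (Fin.castAdd k i) + ((L j).2 : ℝ))|) ∧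
      w = KZ.of s₁}, w - c' ∈ KZ.relations by
    obtain ⟨c', hc', hcc⟩ := SepTwoZero.closure_transfer' hpieces c hc
    refine ⟨c', hc', ?_⟩
    have := add_mem hrel hcc
    rwa [sub_add_sub_cancel] at this
  -- Step 3: one piece
  rintro w ⟨m₁, M₁, s₁, hold, hnew, hbd₁, hdom₁, hint₁, rfl⟩
  have hsub : s₁.domain ⊆ s.domain := by
    rw [hdom₁, hdom]
    exact piece_subset M M₁ lo hi hold
  have hsign : ∀ g ∈ S, (∀ z ∈ s₁.domain, 0 < ev g (fun i => z (Fin.castAdd k i))) ∨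
      (∀ z ∈ s₁.domain, ev g (fun i => z (Fin.castAdd k i)) < 0) := fun g hg => by
    have := piece_sign (k := k) M₁ lo hi g (hnew g hg)
    rw [← hdom₁] at this
    exact this
  have hpole₁ : ∀ j, e j ≠ 0 → ∀ z ∈ s₁.domain, ev (L j) (fun i => z (Fin.castAdd k i)) ≠ 0 := by
    intro j hej z hz
    rcases hsign (L j) (hSL j hej) with hpos | hneg
    · exact (hpos z hz).ne'
    · exact (hneg z hz).ne
  -- the good candidate direction for this piece
  have hres : ∀ q ∈ P, ∀ l < N, dv (L q.1) (cand (B + 2) l) ≠ 0 → dv (L q.2) (cand (B + 2) l) ≠ 0 →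
      (∀ z ∈ s₁.domain, 0 < res (L q.1) (L q.2) (cand (B + 2) l) (fun i => z (Fin.castAdd k i))) ∨
      (∀ z ∈ s₁.domain, res (L q.1) (L q.2) (cand (B + 2) l) (fun i => z (Fin.castAdd k i)) < 0) := by
    intro q hq l hl hα hβ
    have h := hsign _ (hSR q hq l hl hα hβ)
    simp only [ev_resForm] at h
    exact h
  obtain ⟨l, -, hgood⟩ := exists_fan_cand s₁.domain (fun z i => z (Fin.castAdd k i)) L P N hη hηbad
    (fun q hq => (Finset.mem_filter.1 hq).2.2.2)
    (fun q hq => ⟨hsign _ (hSL q.1 (Finset.mem_filter.1 hq).2.1),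
      hsign _ (hSL q.2 (Finset.mem_filter.1 hq).2.2.1)⟩) hres hNP
  set v : Fin (B + 2) → ℚ := cand (B + 2) l with hv
  -- the ratio condition on the piece
  have hrat₁ : ∀ j j', e j ≠ 0 → e j' ≠ 0 → dv (L j) v ≠ 0 → dv (L j') v ≠ 0 →
      dv (L j') v • L j ≠ dv (L j) v • L j' →
      ∃ C : ℝ, ∀ z ∈ s₁.domain, |ev (L j') (fun i => z (Fin.castAdd k i))| ≤
        C * |res (L j) (L j') v (fun i => z (Fin.castAdd k i))| := by
    intro j j' hej hej' hα hα' hne'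
    by_cases hind : ∀ μ ν : ℚ, μ • (L j).1 + ν • (L j').1 = 0 → μ = 0 ∧ ν = 0
    · have hq : (j, j') ∈ P := Finset.mem_filter.2 ⟨Finset.mem_univ _, hej, hej', hind⟩
      exact hgood (j, j') hq hα hα'
    · obtain ⟨ρ, hρ, hρle⟩ := res_const_of_dep (L j) (L j') v hind hα hne'
      set Rb : ℝ := (∑ i, |((L j').1 i : ℝ)|) * R₀ + |((L j').2 : ℝ)| with hRb
      have hRb' : ∀ z ∈ s₁.domain, |ev (L j') (fun i => z (Fin.castAdd k i))| ≤ Rb := fun z hz =>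
        abs_ev_le (L j') (hcoord z (hsub hz))
      refine ⟨Rb / ρ, fun z hz => ?_⟩
      rw [div_mul_eq_mul_div, le_div_iff₀ hρ]
      exact mul_le_mul (hRb' z hz) (hρle _) hρ.le ((abs_nonneg _).trans (hRb' z hz))
  -- Step 4: the piece itself, with the direction `v`, is a fan piece
  refine ⟨KZ.of s₁, AddSubgroup.subset_closure ⟨m₁, M₁, s₁, v, cand_last_ne_zero (B + 1) l, hbd₁,
    hdom₁, hint₁, fun j _ hej z hz => hpole₁ j hej z hz, fun j j' hα hα' hej hej' hne' =>
    hrat₁ j j' hej hej' hα hα' hne', rfl⟩, by simp⟩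

end Summit.KontsevichZagierPeriods.ArrangementNormalForm.JanusBands
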